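import Mathlib
import HarnessLib
import Literature.MathematicalPhysics.QuantumLattice.HubbardGrandCanonicalDensity
import Literature.MathematicalPhysics.QuantumLattice.HubbardFreeTorusGroundEnergy
import Literature.MathematicalPhysics.QuantumLattice.TorusCooperSum

/-!
# WeakCouplingBCS / crux `WcbcsBcsConstruction` — the end brackets of the density window from the
# free level counts (stub `stub_densityBracketsOfFreeCounts`, part (D1c) of line `ladder-scale-certified-chain`)

Line `ladder-scale-certified-chain` of crux stmt-HubbardSuperconductivity-2010, registered sub-goal
`stub_densityBracketsOfFreeCounts`. Write `E_L(U,y) = E₀(hubbardTorusWith 2 L 1 U y)` for the grand-canonical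
ground-state energy of the Hubbard torus `(ℤ/Lℤ)²` at hopping `1`, repulsion `U ≥ 0` and chemical potential `y`,
`N_L(U,y) = Re ω₀[hubbardTorusWith 2 L 1 U y](N)` for the tracial ground-state particle number,
`n_L(U,y) = N_{L+1}(U,y)/(L+1)²` for the density along the sides `L + 1`, and
`torusLevelCount L E = #{k ∈ (ℤ/Lℤ)² : ε_L(k) ≤ E}` for the free level-counting function of the band
`ε_L(k) = -2(cos(2πk₁/L) + cos(2πk₂/L))`.

**Theorem** (`stub_densityBracketsOfFreeCounts`). IF for all large sides `L` the free level counts satisfy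
`0.79·L² ≤ 2·torusLevelCount L (-9/25)` and `2·torusLevelCount L (-79/100) ≤ 0.71·L²` (stub (D1b) of the line,
proved elsewhere; here it is the antecedent), THEN with `U₂ = 10⁻⁴`, for every `U ∈ (0, U₂)`,
`liminf_L n_L(U,-4/5) ≤ 1 - 7/25` and `1 - 11/50 ≤ limsup_L n_L(U,-7/20)`.

Proof (folklore finite-volume inequalities; Koma–Tasaki, J. Stat. Phys. 76 (1994) §1 for the set-up).
* Free secants with `≤`-level counts (`wcbcs_free_groundEnergy_sub_le_levelCount`,
  `wcbcs_levelCount_le_free_groundEnergy_sub`): for `r ≥ 0` and `L ≥ 3`,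
  `2r·torusLevelCount L (μ - r) ≤ E_L(0,μ-r) - E_L(0,μ)` and `E_L(0,μ) - E_L(0,μ+r) ≤ 2r·torusLevelCount L (μ + r)`
  (`E_L(0,y) = 2 Σ_k min(ε_L(k) - y, 0)`, `groundEnergy_hubbardTorusWith_zero`; each term of the difference lies in
  `[0, r]`, equals `r` when `ε_L(k) ≤ μ - r`, and vanishes unless `ε_L(k) < μ + r`).
* Interacting, finite volume (`wcbcs_gcNumber_mul_le_levelCount`, `wcbcs_levelCount_sub_le_gcNumber_mul`): the
  Griffiths sandwich `(E_L(U,μ-r) - E_L(U,μ))/r ≤ N_L(U,μ) ≤ (E_L(U,μ) - E_L(U,μ+r))/r` (`gcNumber_torus_mem_Icc_slope`)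
  and the interaction sandwich `0 ≤ E_L(U,y) - E_L(0,y) ≤ U L²` (`groundEnergy_torus_sub_free_mem_Icc`) give
  `2r·torusLevelCount L (μ-r) - U L² ≤ r·N_L(U,μ) ≤ 2r·torusLevelCount L (μ+r) + U L²`.
* With `r = 1/100`: at `μ = -4/5` (`μ + r = -79/100`), `n_L ≤ 0.71 + 100 U ≤ 0.72` for `U ≤ 10⁻⁴` and all large
  `L`, so `liminf ≤ 0.72 = 1 - 7/25` (the densities are `≥ 0`, `gcDensity_torus_mem_Icc`); at `μ = -7/20`
  (`μ - r = -9/25`), `n_L ≥ 0.79 - 100 U ≥ 0.78 = 1 - 11/50` eventually, so `limsup ≥ 0.78` (densities `≤ 2`).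

No definition is introduced; the antecedent (D1b) is NOT proved here.
-/

-- the summit and the problem are both `HubbardSuperconductivity`, so the namespace legitimately repeats it
set_option linter.dupNamespace false

namespace Summit.HubbardSuperconductivity.HubbardSuperconductivity.Theorems

open Literature.MathematicalPhysics.QuantumLattice Literature.Probability.LatticeModels Matrix Filter Finset
open scoped Topology

/-! ### Free torus: the level counts bound the secants of `μ ↦ E₀(hubbardTorusWith 2 L 1 0 μ)` -/

/-- **Upper free secant with `≤`-counts**: for `r ≥ 0` and `L ≥ 3`,
`E₀(hubbardTorusWith 2 L 1 0 μ) - E₀(hubbardTorusWith 2 L 1 0 (μ + r)) ≤ 2 r · #{k : ε_L(k) ≤ μ + r}`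
(raising `μ` by `r` lowers the free energy at most at the rate of the levels filled at `μ + r`;
`groundEnergy_free_le_add_card` with `#{ε_L < μ + r} ≤ #{ε_L ≤ μ + r}`). [folklore] -/
theorem wcbcs_free_groundEnergy_sub_le_levelCount {L : ℕ} [NeZero L] (hL : 3 ≤ L) (μ : ℝ) {r : ℝ}
    (hr : 0 ≤ r) :
    (hubbardTorusWith 2 L 1 0 μ).groundEnergy - (hubbardTorusWith 2 L 1 0 (μ + r)).groundEnergy ≤
      2 * r * (torusLevelCount L (μ + r) : ℝ) := by
  have h1 := groundEnergy_free_le_add_card (L := L) hL (μ := μ + r) (μ' := μ) (by linarith)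
  rw [add_sub_cancel_left] at h1
  have hsub : (univ.filter fun k : TorusSite 2 L => torusBand L k < μ + r) ⊆
      univ.filter fun k : TorusSite 2 L => torusBand L k ≤ μ + r := fun k hk => by
    rw [mem_filter] at hk ⊢
    exact ⟨hk.1, hk.2.le⟩
  have hmono : ((univ.filter fun k : TorusSite 2 L => torusBand L k < μ + r).card : ℝ) ≤
      (torusLevelCount L (μ + r) : ℝ) := by
    rw [torusLevelCount_def]
    exact_mod_cast card_le_card hsub
  have h2 := mul_le_mul_of_nonneg_left hmono (by positivity : (0 : ℝ) ≤ 2 * r)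
  linarith

/-- **Lower free secant with `≤`-counts**: for `r ≥ 0` and `L ≥ 3`,
`2 r · #{k : ε_L(k) ≤ μ - r} ≤ E₀(hubbardTorusWith 2 L 1 0 (μ - r)) - E₀(hubbardTorusWith 2 L 1 0 μ)`
(lowering `μ` by `r` raises the free energy `2 Σ_k min(ε_L(k) - μ, 0)` by exactly `2r` for every level
`ε_L(k) ≤ μ - r`, and by a non-negative amount for every other level). [folklore] -/
theorem wcbcs_levelCount_le_free_groundEnergy_sub {L : ℕ} [NeZero L] (hL : 3 ≤ L) (μ : ℝ) {r : ℝ}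
    (hr : 0 ≤ r) :
    2 * r * (torusLevelCount L (μ - r) : ℝ) ≤
      (hubbardTorusWith 2 L 1 0 (μ - r)).groundEnergy - (hubbardTorusWith 2 L 1 0 μ).groundEnergy := by
  rw [groundEnergy_hubbardTorusWith_zero hL, groundEnergy_hubbardTorusWith_zero hL, ← mul_sub,
    ← Finset.sum_sub_distrib, torusLevelCount_def]
  have hterm : ∀ k : TorusSite 2 L, (if torusBand L k ≤ μ - r then r else 0) ≤
      min (torusBand L k - (μ - r)) 0 - min (torusBand L k - μ) 0 := by
    intro k
    split_ifs with hk
    · rw [min_eq_left (by linarith), min_eq_left (by linarith)]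
      linarith
    · have hmin : min (torusBand L k - μ) 0 ≤ min (torusBand L k - (μ - r)) 0 :=
        le_min ((min_le_left _ _).trans (by linarith)) (min_le_right _ _)
      linarith
  have hsum : ∑ k : TorusSite 2 L, (if torusBand L k ≤ μ - r then r else 0) =
      r * ((univ.filter fun k : TorusSite 2 L => torusBand L k ≤ μ - r).card : ℝ) := by
    rw [← Finset.sum_filter, Finset.sum_const, nsmul_eq_mul, mul_comm]
  have hle := Finset.sum_le_sum fun k (_ : k ∈ (univ : Finset (TorusSite 2 L))) => hterm k
  rw [hsum] at hle
  linarith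

/-! ### Interacting torus, finite volume: the particle number against the free level counts -/

/-- **Upper finite-volume bracket**: for `0 ≤ U`, `0 < r`, `L ≥ 3`,
`r · Re ω₀[hubbardTorusWith 2 L 1 U μ](N) ≤ 2 r · #{k : ε_L(k) ≤ μ + r} + U L²` (Griffiths sandwich
`gcNumber_torus_mem_Icc_slope`, interaction sandwich `groundEnergy_torus_sub_free_mem_Icc`, and the upper free
secant). [cite: KomaTasaki1994, §1] -/
theorem wcbcs_gcNumber_mul_le_levelCount {L : ℕ} [NeZero L] (hL : 3 ≤ L) {U : ℝ} (hU : 0 ≤ U) (μ : ℝ)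
    {r : ℝ} (hr : 0 < r) :
    ((hubbardTorusWith 2 L 1 U μ).groundStateFunctional totalNumber).re * r ≤
      2 * r * (torusLevelCount L (μ + r) : ℝ) + U * (L : ℝ) ^ 2 := by
  obtain ⟨-, h2⟩ := gcNumber_torus_mem_Icc_slope L 1 U μ hr
  rw [le_div_iff₀ hr] at h2
  obtain ⟨-, hμ⟩ := groundEnergy_torus_sub_free_mem_Icc L 1 μ hU
  obtain ⟨hμr, -⟩ := groundEnergy_torus_sub_free_mem_Icc L 1 (μ + r) hU
  have hfree := wcbcs_free_groundEnergy_sub_le_levelCount hL μ hr.le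
  linarith

/-- **Lower finite-volume bracket**: for `0 ≤ U`, `0 < r`, `L ≥ 3`,
`2 r · #{k : ε_L(k) ≤ μ - r} - U L² ≤ r · Re ω₀[hubbardTorusWith 2 L 1 U μ](N)` (Griffiths sandwich,
interaction sandwich, and the lower free secant). [cite: KomaTasaki1994, §1] -/
theorem wcbcs_levelCount_sub_le_gcNumber_mul {L : ℕ} [NeZero L] (hL : 3 ≤ L) {U : ℝ} (hU : 0 ≤ U) (μ : ℝ)
    {r : ℝ} (hr : 0 < r) :
    2 * r * (torusLevelCount L (μ - r) : ℝ) - U * (L : ℝ) ^ 2 ≤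
      ((hubbardTorusWith 2 L 1 U μ).groundStateFunctional totalNumber).re * r := by
  obtain ⟨h1, -⟩ := gcNumber_torus_mem_Icc_slope L 1 U μ hr
  rw [div_le_iff₀ hr] at h1
  obtain ⟨-, hμ⟩ := groundEnergy_torus_sub_free_mem_Icc L 1 μ hU
  obtain ⟨hμr, -⟩ := groundEnergy_torus_sub_free_mem_Icc L 1 (μ - r) hU
  have hfree := wcbcs_levelCount_le_free_groundEnergy_sub hL μ hr.le
  linarith

/-! ### The registered stub -/

/-- **Stub (D1c) `stub_densityBracketsOfFreeCounts`** of line `ladder-scale-certified-chain` (crux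
`WcbcsBcsConstruction`): given the free level counts `0.79·L² ≤ 2·#{ε_L ≤ -9/25}` and
`2·#{ε_L ≤ -79/100} ≤ 0.71·L²` for all large `L` (stub (D1b), the antecedent), there is `U₂ > 0` (here `10⁻⁴`)
such that for every `U ∈ (0, U₂)` the tracial grand-canonical ground-state densities of `hubbardTorusWith 2 (L+1) 1 U ·`
per `(L+1)²` satisfy `liminf_L n_L(U,-4/5) ≤ 1 - 7/25` and `1 - 11/50 ≤ limsup_L n_L(U,-7/20)` (finite-volume
brackets at step `r = 1/100`: `n_L(U,-4/5) ≤ 0.71 + 100U`, `n_L(U,-7/20) ≥ 0.79 - 100U` eventually).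
[cite: KomaTasaki1994, §1] -/
theorem stub_densityBracketsOfFreeCounts :
    (∃ L₁ : ℕ, ∀ L : ℕ, L₁ ≤ L → ∀ [NeZero L],
      (79 / 100 : ℝ) * (L : ℝ) ^ 2 ≤ 2 * (torusLevelCount L (-(9:ℝ) / 25) : ℝ) ∧
      2 * (torusLevelCount L (-(79:ℝ) / 100) : ℝ) ≤ (71 / 100 : ℝ) * (L : ℝ) ^ 2) →
    ∃ U₂ : ℝ, 0 < U₂ ∧ ∀ U ∈ Set.Ioo (0:ℝ) U₂,
      liminf (fun L : ℕ => ((hubbardTorusWith 2 (L + 1) 1 U (-(4:ℝ) / 5)).groundStateFunctional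
        totalNumber).re / ((L + 1 : ℕ) : ℝ) ^ 2) atTop ≤ 1 - 7 / 25 ∧
      1 - 11 / 50 ≤ limsup (fun L : ℕ => ((hubbardTorusWith 2 (L + 1) 1 U (-(7:ℝ) / 20)).groundStateFunctional
        totalNumber).re / ((L + 1 : ℕ) : ℝ) ^ 2) atTop := by
  rintro ⟨L₁, hL₁⟩
  refine ⟨1 / 10000, by norm_num, fun U hU => ?_⟩
  obtain ⟨hU0, hU1⟩ := hU
  have hV : ∀ L : ℕ, (0 : ℝ) < ((L + 1 : ℕ) : ℝ) ^ 2 := fun L => by positivity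
  have hUV : ∀ L : ℕ, U * ((L + 1 : ℕ) : ℝ) ^ 2 ≤ 1 / 10000 * ((L + 1 : ℕ) : ℝ) ^ 2 := fun L =>
    mul_le_mul_of_nonneg_right hU1.le (hV L).le
  constructor
  · -- at `μ = -4/5`: eventually `n_L ≤ 0.71 + 100 U ≤ 0.72`, and the densities are `≥ 0`
    have hev : ∀ᶠ L : ℕ in atTop, ((hubbardTorusWith 2 (L + 1) 1 U (-(4:ℝ) / 5)).groundStateFunctional
        totalNumber).re / ((L + 1 : ℕ) : ℝ) ^ 2 ≤ 1 - 7 / 25 := by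
      refine eventually_atTop.2 ⟨L₁ + 2, fun L hL => ?_⟩
      obtain ⟨-, hcount⟩ := hL₁ (L + 1) (by omega)
      have hbound := wcbcs_gcNumber_mul_le_levelCount (L := L + 1) (by omega) hU0.le (-(4:ℝ) / 5)
        (r := 1 / 100) (by norm_num)
      rw [show (-(4:ℝ) / 5 + 1 / 100 : ℝ) = -(79:ℝ) / 100 by norm_num] at hbound
      rw [div_le_iff₀ (hV L)]
      have hUV' := hUV L
      push_cast at hcount hbound hUV' ⊢
      linarith
    exact liminf_le_of_frequently_le hev.frequently
      (isBoundedUnder_of_eventually_ge (a := 0) (Eventually.of_forall fun L =>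
        (gcDensity_torus_mem_Icc (L + 1) 1 U _).1))
  · -- at `μ = -7/20`: eventually `n_L ≥ 0.79 - 100 U ≥ 0.78`, and the densities are `≤ 2`
    have hev : ∀ᶠ L : ℕ in atTop, 1 - 11 / 50 ≤
        ((hubbardTorusWith 2 (L + 1) 1 U (-(7:ℝ) / 20)).groundStateFunctional
          totalNumber).re / ((L + 1 : ℕ) : ℝ) ^ 2 := by
      refine eventually_atTop.2 ⟨L₁ + 2, fun L hL => ?_⟩
      obtain ⟨hcount, -⟩ := hL₁ (L + 1) (by omega)
      have hbound := wcbcs_levelCount_sub_le_gcNumber_mul (L := L + 1) (by omega) hU0.le (-(7:ℝ) / 20)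
        (r := 1 / 100) (by norm_num)
      rw [show (-(7:ℝ) / 20 - 1 / 100 : ℝ) = -(9:ℝ) / 25 by norm_num] at hbound
      rw [le_div_iff₀ (hV L)]
      have hUV' := hUV L
      push_cast at hcount hbound hUV' ⊢
      linarith
    exact le_limsup_of_frequently_le hev.frequently
      (isBoundedUnder_of_eventually_le (a := 2) (Eventually.of_forall fun L =>
        (gcDensity_torus_mem_Icc (L + 1) 1 U _).2))

end Summit.HubbardSuperconductivity.HubbardSuperconductivity.Theorems
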